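import Mathlib
import Literature.Geometry.DiscreteGeometry.KissingPatterns
import Summits.AtomisticToContinuum.Crystallization.Theses.GappedShellCensus

/-!
# `CleanLimitsHaveWindows` (stmt-AtomisticToContinuum-15932), line `Sketch` — helper for stub K0:
# torn-freeness of clean sets from the sibling crux `TornFree`

Support file for the skeleton of the crux `GappedShellCensus.CleanLimitsHaveWindows`. Stub K0
(`stub_cleanTornFree`) says: in an everywhere-CLEAN set `Y ⊆ ℝ³` at scale `a > 0` (every site has
exactly twelve points of `Y` in `[0.98a, 1.02a]`, none closer, none in the open annulus
`(1.02a, 1.26a)`, and its recentred, rescaled bond shell is `1/5`-matched after a rotation to the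
fcc or the hcp kissing pattern) every bond `(y, v)` has at least four common bonded neighbours.

This is exactly the conclusion of the sibling route crux `GappedShellCensus.TornFree`
(stmt-AtomisticToContinuum-18069), whose hypothesis is only the first conjunct (gapped twelve at every
site) of cleanness. This file records the one-line bridge `TornFree → K0`: drop the shell-matching
clause.
-/

noncomputable section

namespace Summit.AtomisticToContinuum.Crystallization.Theorems.CleanHull

open Literature.MathematicalPhysics.StatisticalMechanics
open Literature.Geometry.DiscreteGeometry

/-- **K0 from `TornFree`.** If every all-gapped-twelve configuration is torn-free (the sibling crux
`GappedShellCensus.TornFree`, stmt-AtomisticToContinuum-18069), then in particular every everywhere-clean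
set is torn-free: every bond `(y, v)` of a clean `Y` has at least four common bonded neighbours (the
shell-matching clause of cleanness is simply dropped). [folklore] -/
theorem cleanTornFree_of_tornFree :
    Summit.AtomisticToContinuum.Crystallization.Theses.GappedShellCensus.TornFree →
    ∀ (Y : Set (EuclideanSpace ℝ (Fin 3))) (a : ℝ), 0 < a →
    (∀ y ∈ Y, ({w ∈ Y | w ≠ y ∧ dist y w ≤ a * (1 + 1 / 50)}.ncard = 12 ∧
        ∀ w ∈ Y, w ≠ y → a * (1 - 1 / 50) ≤ dist y w ∧
          (dist y w ≤ a * (1 + 1 / 50) ∨ a * (63 / 50) ≤ dist y w)) ∧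
      ∃ T : Finset (EuclideanSpace ℝ (Fin 3)), (↑T : Set (EuclideanSpace ℝ (Fin 3))) =
          (fun w => a⁻¹ • (w - y)) '' {w ∈ Y | w ≠ y ∧ dist y w ≤ a * (1 + 1 / 50)} ∧
        (ShellCloseTo (1 / 5) T fccKissingPattern ∨ ShellCloseTo (1 / 5) T hcpKissingPattern)) →
    ∀ y ∈ Y, ∀ v ∈ Y, v ≠ y → dist y v ≤ a * (1 + 1 / 50) →
      4 ≤ {w ∈ Y | w ≠ y ∧ w ≠ v ∧ dist y w ≤ a * (1 + 1 / 50) ∧ dist v w ≤ a * (1 + 1 / 50)}.ncard := by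
  intro h Y a ha hclean
  exact h Y a ha (fun y hy => (hclean y hy).1)

end Summit.AtomisticToContinuum.Crystallization.Theorems.CleanHull

end
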